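import Literature.AlgebraicGeometry.Resolution.AlterationsProofs
import Literature.AlgebraicGeometry.Motives.CartierDivisor
import HarnessLib

/-!
# `WildQuotients.SummitReduction` (stmt-ResolutionOfSingularities-16324), line `FramePerfect`:
# transfer lemmas for de Jong's Galois alteration datum (faithful image; descent along purely
# inseparable alterations and modifications)

Route `ResolutionOfSingularities/WildQuotients`, crux `SummitReduction`. The line's one open stub,
`stub_deJong1997_galoisAlteration_perfect` (skeleton `Cruxes/SummitReduction/Lines/FramePerfect.lean`),
asks, for a normal projective integral `X` over a perfect field of characteristic `p`, for de Jong's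
GALOIS ALTERATION DATUM of `X`: a finite group `G`, a regular integral `X₁` all of whose finite
subsets lie in affine opens, a FAITHFUL action `ρ : G →* Aut X₁`, and a `G`-invariant alteration
`π : X₁ ⟶ X` with `K(X) ⊂ K(X₁)^G` purely inseparable, the last condition rendered on function
fields: every `a ∈ K(X₁)` fixed by all `(ρ g)♯` has `a ^ q ^ n ∈ π♯(K(X))` for some `n`,
`q = ringExpChar K(X)` (de Jong 1997, 5.3 / (5.12.1) / Thm. 5.13 / Cor. 5.15).

This helper file (supports the crux; it does not close it) proves the hypothesis-free TRANSFER
steps that every run of de Jong's induction uses, in exactly the stub's format (the third free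
clause, faithfulness of the action, is `galoisAlterationDatum_faithful` of the sibling file
`…WildQuotientsGaloisReductionPerfectSqueeze`, stmt-15641; it is re-proved inline below where
needed so that this file imports Literature modules only):

* `galoisAlterationDatum_of_isAlteration_of_pow_mem` — DESCENT ALONG PURELY INSEPARABLE
  ALTERATIONS (de Jong 1997, last sentence of the proof of Cor. 5.15; de Jong 1996, 2.20): if
  `m : X̃ ⟶ X` is an alteration whose function field extension is purely inseparable
  (`b ^ q ^ n ∈ m♯(K(X))` for every `b ∈ K(X̃)`), a datum of `X̃` composed with `m` is a datum of
  `X`; in particular (`…_of_surjective`) along MODIFICATIONS and any alteration inducing an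
  isomorphism of function fields (normalisation, blow-ups, Chow covers) — the "we may replace `X`
  by `X̃`" steps of de Jong 1996, 4.4–4.12 / de Jong 1997, proof of 5.13;
* `galoisAlterationDatum_trans` — TRANSITIVITY (de Jong 1997, 5.3–5.4): a `φ`-equivariant regular
  Galois alteration `(X₁, G₁)` of a (not necessarily regular) Galois alteration `(X', G')` of
  `(X, {1})` is a Galois alteration datum of `X` — the shape in which the induction of Thm. 5.13
  returns its output.

Everything is over arbitrary integral schemes (no ground field, characteristic or perfectness
hypothesis is used); the exponential characteristics of `K(X̃)` and `K(X)` agree along `m♯`.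
-/

set_option linter.dupNamespace false

noncomputable section

open CategoryTheory AlgebraicGeometry TopologicalSpace
open Literature.AlgebraicGeometry.Resolution
open Literature.AlgebraicGeometry.Motives (RatFn.functionFieldMap RatFn.functionFieldMap_comp)
open Literature.AlgebraicGeometry

namespace Summit.ResolutionOfSingularities.ResolutionOfSingularities.Theorems

/-! ## Descent along purely inseparable alterations and modifications -/

/-- **Descent of the datum along a purely inseparable alteration** (transitivity of Galois
alterations with trivial group downstairs). Let `m : X̃ ⟶ X` be an alteration of integral schemes
whose function field extension `m♯ : K(X) → K(X̃)` is purely inseparable — every `b ∈ K(X̃)` has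
`b ^ q ^ n ∈ m♯(K(X))` for some `n`, `q = ringExpChar K(X)`. Then a Galois alteration datum
`(G, X₁, ρ, π)` of `X̃` gives the datum `(G, X₁, ρ, π ≫ m)` of `X`: alterations compose (de Jong
1996, 2.20), invariance composes, and for `a ∈ K(X₁)^G` with `a ^ {q'} ^ n = π♯ c` and
`c ^ q ^ n' = m♯ d` one gets `a ^ q ^ (n + n') = (π ≫ m)♯ d`, using `q' = ringExpChar K(X̃) = q`.
This is the last sentence of de Jong's proof of Cor. 5.15 ("This implies (5.12.1) for `X` as
`R(X) ⊂ R(X')` is purely inseparable"). [cite: DeJong1997, proof of Cor. 5.15, p. 620; 5.3, p. 613]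
[cite: DeJong1996, 2.20, p. 61] -/
theorem galoisAlterationDatum_of_isAlteration_of_pow_mem {X Y : Scheme.{0}} [IsIntegral X]
    [IsIntegral Y] (m : Y ⟶ X) (hm : IsAlteration m) [IsDominant m]
    (hmpi : ∀ b : Y.functionField,
      ∃ n : ℕ, b ^ ringExpChar X.functionField ^ n ∈ Set.range (RatFn.functionFieldMap m))
    (h : ∃ (G : Type) (_ : Group G) (_ : Finite G) (X₁ : Scheme.{0}) (_ : IsIntegral X₁)
      (ρ : G →* Aut X₁) (π : X₁ ⟶ Y) (_ : IsDominant π),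
      IsAlteration π ∧ Scheme.IsRegular X₁ ∧ Function.Injective ρ ∧
      (∀ g : G, (ρ g).hom ≫ π = π) ∧
      (∀ S : Finset X₁, ∃ U : X₁.Opens, IsAffineOpen U ∧ (↑S : Set X₁) ⊆ U) ∧
      (∀ a : X₁.functionField, (∀ g : G, RatFn.functionFieldMap (ρ g).hom a = a) →
        ∃ n : ℕ, a ^ ringExpChar Y.functionField ^ n ∈ Set.range (RatFn.functionFieldMap π))) :
    ∃ (G : Type) (_ : Group G) (_ : Finite G) (X₁ : Scheme.{0}) (_ : IsIntegral X₁)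
      (ρ : G →* Aut X₁) (π : X₁ ⟶ X) (_ : IsDominant π),
      IsAlteration π ∧ Scheme.IsRegular X₁ ∧ Function.Injective ρ ∧
      (∀ g : G, (ρ g).hom ≫ π = π) ∧
      (∀ S : Finset X₁, ∃ U : X₁.Opens, IsAffineOpen U ∧ (↑S : Set X₁) ⊆ U) ∧
      (∀ a : X₁.functionField, (∀ g : G, RatFn.functionFieldMap (ρ g).hom a = a) →
        ∃ n : ℕ, a ^ ringExpChar X.functionField ^ n ∈ Set.range (RatFn.functionFieldMap π)) := by
  obtain ⟨G, _, _, X₁, _, ρ, π, _, hπ, hreg, hinj, hinv, hAF, hd⟩ := h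
  -- the exponential characteristics of `K(X)` and `K(Y)` agree along the field map `m♯`
  obtain ⟨q, hq⟩ := ExpChar.exists X.functionField
  haveI : ExpChar Y.functionField q :=
    expChar_of_injective_ringHom (RatFn.functionFieldMap m).injective q
  have hqX : ringExpChar X.functionField = q := ringExpChar.eq _ q
  have hqY : ringExpChar Y.functionField = q := ringExpChar.eq _ q
  haveI : IsDominant (π ≫ m) := inferInstance
  refine ⟨G, inferInstance, inferInstance, X₁, inferInstance, ρ, π ≫ m, inferInstance,
    hπ.comp hm, hreg, hinj, fun g => by rw [← Category.assoc, hinv g], hAF, ?_⟩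
  intro a ha
  obtain ⟨n, c, hc⟩ := hd a ha
  obtain ⟨n', d, hd'⟩ := hmpi c
  refine ⟨n + n', d, ?_⟩
  rw [hqX] at hd' ⊢
  rw [hqY] at hc
  rw [RatFn.functionFieldMap_comp m π, RingHom.comp_apply, hd', map_pow, hc, ← pow_mul, ← pow_add]

/-- **Descent of the datum along a modification** (or any alteration inducing an isomorphism —
equivalently a surjection — of function fields: normalisation, blow-ups, Chow covers, projective
compactification followed by restriction): the special case `n = 0` of
`galoisAlterationDatum_of_isAlteration_of_pow_mem`. [cite: DeJong1996, 2.20 and 4.4, pp. 61, 66] -/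
theorem galoisAlterationDatum_of_isAlteration_of_surjective {X Y : Scheme.{0}} [IsIntegral X]
    [IsIntegral Y] (m : Y ⟶ X) (hm : IsAlteration m) [IsDominant m]
    (hsurj : Function.Surjective (RatFn.functionFieldMap m))
    (h : ∃ (G : Type) (_ : Group G) (_ : Finite G) (X₁ : Scheme.{0}) (_ : IsIntegral X₁)
      (ρ : G →* Aut X₁) (π : X₁ ⟶ Y) (_ : IsDominant π),
      IsAlteration π ∧ Scheme.IsRegular X₁ ∧ Function.Injective ρ ∧
      (∀ g : G, (ρ g).hom ≫ π = π) ∧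
      (∀ S : Finset X₁, ∃ U : X₁.Opens, IsAffineOpen U ∧ (↑S : Set X₁) ⊆ U) ∧
      (∀ a : X₁.functionField, (∀ g : G, RatFn.functionFieldMap (ρ g).hom a = a) →
        ∃ n : ℕ, a ^ ringExpChar Y.functionField ^ n ∈ Set.range (RatFn.functionFieldMap π))) :
    ∃ (G : Type) (_ : Group G) (_ : Finite G) (X₁ : Scheme.{0}) (_ : IsIntegral X₁)
      (ρ : G →* Aut X₁) (π : X₁ ⟶ X) (_ : IsDominant π),
      IsAlteration π ∧ Scheme.IsRegular X₁ ∧ Function.Injective ρ ∧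
      (∀ g : G, (ρ g).hom ≫ π = π) ∧
      (∀ S : Finset X₁, ∃ U : X₁.Opens, IsAffineOpen U ∧ (↑S : Set X₁) ⊆ U) ∧
      (∀ a : X₁.functionField, (∀ g : G, RatFn.functionFieldMap (ρ g).hom a = a) →
        ∃ n : ℕ, a ^ ringExpChar X.functionField ^ n ∈ Set.range (RatFn.functionFieldMap π)) :=
  galoisAlterationDatum_of_isAlteration_of_pow_mem m hm
    (fun b => ⟨0, by rw [pow_zero, pow_one]; exact hsurj b⟩) h

/-! ## Transitivity: a Galois alteration of a Galois alteration -/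

/-- **Transitivity of Galois alterations** (de Jong 1997, 5.3–5.4, with the trivial group
downstairs; used at every step of the proof of Thm. 5.13: "`X₁' → X₁'` is a Galois alteration as
well"). Let `(X', G', ρ', π')` be a Galois alteration of `(X, {1})` in the weak sense — `π'` a
`G'`-invariant alteration with `K(X) ⊂ K(X')^{G'}` purely inseparable, `X'` NOT assumed regular —
and let `(X₁, G₁, ρ₁, π₁)` with a homomorphism `φ : G₁ →* G'` be a `φ`-EQUIVARIANT regular Galois
alteration of `(X', G')`: `(ρ₁ g) ≫ π₁ = π₁ ≫ ρ' (φ g)` and `K(X')^{G'} ⊂ K(X₁)^{G₁}` purely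
inseparable (5.3 (d)). Then `(X₁, im ρ₁, π₁ ≫ π')` is a Galois alteration datum of `X` in the
stub's format (faithful group: pass to the image `ρ₁.range ≤ Aut X₁`). No surjectivity of `φ`
and no kernel condition (5.4.1) is needed for this direction. [cite: DeJong1997, 5.3–5.4, pp. 613–614] -/
theorem galoisAlterationDatum_trans {X X' : Scheme.{0}} [IsIntegral X] [IsIntegral X']
    {G' : Type} [Group G'] (ρ' : G' →* Aut X') (π' : X' ⟶ X) (hπ' : IsAlteration π')
    [IsDominant π'] (hinv' : ∀ g : G', (ρ' g).hom ≫ π' = π')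
    (hd' : ∀ a : X'.functionField, (∀ g : G', RatFn.functionFieldMap (ρ' g).hom a = a) →
      ∃ n : ℕ, a ^ ringExpChar X.functionField ^ n ∈ Set.range (RatFn.functionFieldMap π'))
    (h : ∃ (G₁ : Type) (_ : Group G₁) (_ : Finite G₁) (X₁ : Scheme.{0}) (_ : IsIntegral X₁)
      (ρ₁ : G₁ →* Aut X₁) (φ : G₁ →* G') (π₁ : X₁ ⟶ X') (_ : IsDominant π₁),
      IsAlteration π₁ ∧ Scheme.IsRegular X₁ ∧
      (∀ g : G₁, (ρ₁ g).hom ≫ π₁ = π₁ ≫ (ρ' (φ g)).hom) ∧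
      (∀ S : Finset X₁, ∃ U : X₁.Opens, IsAffineOpen U ∧ (↑S : Set X₁) ⊆ U) ∧
      (∀ a : X₁.functionField, (∀ g : G₁, RatFn.functionFieldMap (ρ₁ g).hom a = a) →
        ∃ (n : ℕ) (c : X'.functionField), (∀ g : G', RatFn.functionFieldMap (ρ' g).hom c = c) ∧
          a ^ ringExpChar X'.functionField ^ n = RatFn.functionFieldMap π₁ c)) :
    ∃ (G : Type) (_ : Group G) (_ : Finite G) (X₁ : Scheme.{0}) (_ : IsIntegral X₁)
      (ρ : G →* Aut X₁) (π : X₁ ⟶ X) (_ : IsDominant π),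
      IsAlteration π ∧ Scheme.IsRegular X₁ ∧ Function.Injective ρ ∧
      (∀ g : G, (ρ g).hom ≫ π = π) ∧
      (∀ S : Finset X₁, ∃ U : X₁.Opens, IsAffineOpen U ∧ (↑S : Set X₁) ⊆ U) ∧
      (∀ a : X₁.functionField, (∀ g : G, RatFn.functionFieldMap (ρ g).hom a = a) →
        ∃ n : ℕ, a ^ ringExpChar X.functionField ^ n ∈ Set.range (RatFn.functionFieldMap π)) := by
  obtain ⟨G₁, _, _, X₁, _, ρ₁, φ, π₁, _, hπ₁, hreg, hequiv, hAF, hd₁⟩ := h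
  -- the exponential characteristics of `K(X)` and `K(X')` agree along the field map `π'♯`
  obtain ⟨q, hq⟩ := ExpChar.exists X.functionField
  haveI : ExpChar X'.functionField q :=
    expChar_of_injective_ringHom (RatFn.functionFieldMap π').injective q
  have hqX : ringExpChar X.functionField = q := ringExpChar.eq _ q
  have hqX' : ringExpChar X'.functionField = q := ringExpChar.eq _ q
  haveI : IsDominant (π₁ ≫ π') := inferInstance
  -- invariance: `ρ₁ g ≫ π₁ ≫ π' = π₁ ≫ ρ' (φ g) ≫ π' = π₁ ≫ π'`
  have hinv₁ : ∀ g : G₁, (ρ₁ g).hom ≫ π₁ ≫ π' = π₁ ≫ π' := fun g => by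
    rw [← Category.assoc, hequiv g, Category.assoc, hinv' (φ g)]
  -- (d): towers of purely inseparable extensions
  have hd : ∀ a : X₁.functionField, (∀ g : G₁, RatFn.functionFieldMap (ρ₁ g).hom a = a) →
      ∃ n : ℕ, a ^ ringExpChar X.functionField ^ n ∈
        Set.range (RatFn.functionFieldMap (π₁ ≫ π')) := by
    intro a ha
    obtain ⟨n, c, hc, hac⟩ := hd₁ a ha
    obtain ⟨n', d, hd⟩ := hd' c hc
    refine ⟨n + n', d, ?_⟩
    rw [hqX] at hd ⊢
    rw [hqX'] at hac
    rw [RatFn.functionFieldMap_comp π' π₁, RingHom.comp_apply, hd, map_pow, ← hac, ← pow_mul,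
      ← pow_add]
  -- faithful image: replace `G₁` by `ρ₁.range ≤ Aut X₁` (cf. `galoisAlterationDatum_faithful`)
  haveI : Finite ρ₁.range := Finite.of_surjective _ ρ₁.rangeRestrict_surjective
  refine ⟨ρ₁.range, inferInstance, inferInstance, X₁, inferInstance, ρ₁.range.subtype, π₁ ≫ π',
    inferInstance, hπ₁.comp hπ', hreg, ρ₁.range.subtype_injective, ?_, hAF, fun a ha =>
    hd a fun g => ha ⟨ρ₁ g, g, rfl⟩⟩
  rintro ⟨_, g, rfl⟩
  exact hinv₁ g

end Summit.ResolutionOfSingularities.ResolutionOfSingularities.Theorems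

end
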